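/-
Copyright: the b2b-balaban T⁴-continuum CRUX team, row NE7b OWNER lineage `t4-ne7b-p1` (gen 129). Project licence.
-/
import Summits.QuantumFields.BalabanUV.T4Continuum.Spine.NE7b.SupSmallFieldGasReal

/-!
# THE SMALL-FIELD EFFECTIVE ACTION IS A LOCAL FUNCTIONAL OF THE EXTERNAL FIELD: if two families of cell factors have the SAME activities on
# the polymers avoiding a cell set `D`, their Kotecký–Preiss logarithms differ by at most `2·#D·(Δ+1)·2eε` — only clusters pinned at `D`
# see the difference — and for the road's step this reads: changing the external field `ψ` on the cells of `D ⊆ S` only changes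
# `log ∫e^{−Σ_{p∈S}Σ_{x∈cell p}w_x(ω_x+ψ_x)}dN(0,Γ)` by at most `2·#D·(Δ+1)·2e·ε_ΨA^v`, UNIFORMLY IN THE VOLUME `S` (row NE7b, node U5c; the
# tree's cluster expansion `pertLogZ = Σ_𝒞 Φ^T(𝒞)` + `truncatedWeight_congr` + (287)'s pinned cluster sums + (306)'s real bridge BY NAME;
# [folklore])

Cell `pub-balaban`, sub-cell `t4`, spine estimate NE7b (`T4WeightBudget.RelWeightBound`; the cell's OWN estimate — NOT PRINTED in
[Bałaban 1983–89], NOT PROVED).  Crux-route work under `Spine/NE7b/` by the row OWNER (`t4-ne7b-p1` gen 129, file (311)) under FREEZE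
(0)'s crux-prover clause, on § [NE7bP1-G128-HANDOFF] NEXT (3)(c) (what the ITERATION consumes: the next step needs the effective action
`−log Z_ψ` to be LOCAL in `ψ`); NOTHING of Bałaban's is named as a Lean object, valued or asserted; no `T4Continuum/Support` leaf typed; no
`def`, no notation; zero `sorry`.  Imports (BY NAME): the OWNER's (306) `…SupSmallFieldGasReal` (`shifted_exp_pertLogZ_on`,
`pertZ_road_shift_eq`) and through it (296) (`pertLogZ_cutoff`, `cellActivity_cutoff_of_subset`, `cutoff_measurable`, `cutoff_shifted_regulated`,
`shifted_norm_pertLogZ_le_on`), (292) (`shifted_measurable`), (290) (`road_factor_norm_le`, `road_factor_measurable`, `road_eps_nonneg`),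
(289) (`norm_cellActivity_le_of_regulated`), (287) (`act_sum_norm_truncatedWeight_touching_le`); the tree's `pertLogZ_eq_sum_truncatedWeight`,
`truncatedWeight_congr`, `mem_rconnSubsets`, `KPTouches`, `symm_of_inst`; Mathlib's `Finset.sum_filter_of_ne`, `Finset.sum_comm'`,
`Complex.norm_exp`, `Complex.abs_re_le_norm`.

WHY (located).  (307)∕(309)∕(310) control the SIZE of the step's logarithm; the iteration of a renormalisation-group map needs its
STRUCTURE: the effective action must again be a sum of local terms.  The cluster expansion gives exactly this — `log Z_ψ(S) = Σ_𝒞 Φ^T_ψ(𝒞)`,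
each cluster weight depending on `ψ` only through the cells its polymers cover — and the quantitative form that survives in one line is the
LOCALITY ESTIMATE: two external fields that agree off `D` have effective actions within `O(ε·#D)`, because only the clusters pinned at `D`
(total weight `≤ #D(Δ+1)2eε` by (287)) can tell them apart.  §1 is the abstract statement at the activity level, §3 the road's.

WHAT IS PROVED ([folklore]):
* §1 ACTIVITY LEVEL **`act_norm_pertLogZ_sub_le_of_agree`**: `R` symmetric with `≤ Δ` neighbours, two factor families with
  `‖M(K)‖, ‖M'(K)‖ ≤ ε^{#K}` on `R`-connected `K`, `eε(Δ+1)² ≤ 1∕2`, and `M(K) = M'(K)` for `K ⊆ C` disjoint from `D` ⟹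
  `‖log Z(C) − log Z'(C)‖ ≤ 2·#D·(Δ+1)·2eε` (`sum_norm_le_sum_pinned`: a nonnegative cluster functional summed over the clusters touching SOME cell
  of `D` is at most its pinned sums summed over `q ∈ D`);
* §2 bridges: `re_eq_log_of_exp_eq` (`e^z = ↑r`, `r > 0` ⟹ `Re z = log r`), `road_shift_prod_congr` ∕ `road_shift_cellActivity_congr` (the road's
  shifted factors over `K` see `ψ` only on `⋃_{p∈K}cell p`);
* §3 THE END **`abs_log_smallField_sub_le`**: the hypotheses of (306)'s small-field theorem for `ψ` AND `ψ'` on the region `S`, and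
  `ψ_x = ψ'_x` for `x ∈ cell p`, `p ∈ S ∖ D` ⟹
  `|log ∫e^{−Σ_{p∈S}Σ_{cell p}w(ω+ψ)}dN(0,Γ) − log ∫e^{−Σ_{p∈S}Σ_{cell p}w(ω+ψ')}dN(0,Γ)| ≤ 2·#D·(Δ+1)·2e·ε_Ψ(h)A_τ^v`; §4 toy.

HONEST (what this is NOT).  Locality as a Lipschitz-type bound under localised changes of `ψ` (no derivative, no explicit local
decomposition `Σ_X E(X, ψ|_X)` with exponential tails — the tree's decay weights `τ#Y` would give the latter and are the successor's);
scalar skeleton ((A3), NC-NE7b-α UNRULED); nothing of Bałaban's asserted.  BY-NAME EFFECT ON THE WALL: NONE.  NE7b NOT PRINTED ∕ NOT PROVED;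
spine PROVED 0∕9; rung (B)+1 — the programme's measures remain FINITE-torus statements; NOT the mass gap, NOT Clay.  HONEST DEPENDENCY:
continuum YM on T⁴ ⇐ BetaPertH ∧ nine spine estimates (0∕9 proved); BetaPertH ⇐ (D1) ∧ (D4) ∧ CAP+tail; G-an2-4 gates asym, D1 and NE2∕3∕4.
-/

set_option autoImplicit false

noncomputable section

namespace Summit.QuantumFields.BalabanUV.T4Continuum.NE7b.SupEffectiveActionLocality

open MeasureTheory ProbabilityTheory Finset Real
open scoped BigOperators
open Literature.Probability.LatticeModels (Touches GeomInc IsRConnected KPTouches pertZ cellActivity connActivity pertLogZ rconnSubsets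
  mem_rconnSubsets truncatedWeight truncatedWeight_congr pertLogZ_eq_sum_truncatedWeight symm_of_inst)
open Literature.Analysis.Matrix (HasFiniteRange)
open SupActivityPolymerGas (act_sum_norm_truncatedWeight_touching_le)
open SupRegulatedActivityBound (norm_cellActivity_le_of_regulated)
open SupRegulatedActivityShift (shifted_measurable)
open SupRoadFactorRegulated (road_factor_norm_le road_factor_measurable road_eps_nonneg)
open SupLocalisedPolymerGas (pertLogZ_cutoff cellActivity_cutoff_of_subset cutoff_measurable cutoff_shifted_regulated
  shifted_norm_pertLogZ_le_on)
open SupSmallFieldGasReal (shifted_exp_pertLogZ_on pertZ_road_shift_eq)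

variable {V : Type*} [DecidableEq V]

/-! ## §1. Activity level: clusters avoiding `D` cancel, clusters pinned at `D` weigh `O(ε·#D)` -/

section Activity

variable {Ω : Type*} {mΩ : MeasurableSpace Ω} {μ : Measure Ω} {R : V → V → Prop} [DecidableRel R] {g g' : V → Ω → ℂ} {ε : ℝ}
  {nbr : V → Finset V} {Δ : ℕ}

/-- **A nonnegative cluster functional summed over the clusters touching SOME cell of `D` is at most the sum over `q ∈ D` of its pinned sums.**
[folklore] -/
theorem sum_norm_le_sum_pinned (𝓛 : Finset (Finset (Finset V))) (D : Finset V) (a : Finset (Finset V) → ℝ) (ha : ∀ 𝒞, 0 ≤ a 𝒞) :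
    ∑ 𝒞 ∈ 𝓛 with ∃ q ∈ D, KPTouches (GeomInc R) 𝒞 {q}, a 𝒞 ≤ ∑ q ∈ D, ∑ 𝒞 ∈ 𝓛 with KPTouches (GeomInc R) 𝒞 {q}, a 𝒞 := by
  calc ∑ 𝒞 ∈ 𝓛 with ∃ q ∈ D, KPTouches (GeomInc R) 𝒞 {q}, a 𝒞
      ≤ ∑ 𝒞 ∈ 𝓛 with ∃ q ∈ D, KPTouches (GeomInc R) 𝒞 {q}, ∑ q ∈ D with KPTouches (GeomInc R) 𝒞 {q}, a 𝒞 := by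
        refine sum_le_sum fun 𝒞 h𝒞 => ?_
        obtain ⟨q, hqD, hq⟩ := (mem_filter.1 h𝒞).2
        have hmem : q ∈ D.filter fun q => KPTouches (GeomInc R) 𝒞 {q} := mem_filter.2 ⟨hqD, hq⟩
        calc a 𝒞 = ∑ q' ∈ ({q} : Finset V), a 𝒞 := by simp
          _ ≤ _ := sum_le_sum_of_subset_of_nonneg (by simpa using hmem) fun _ _ _ => ha 𝒞
    _ ≤ ∑ 𝒞 ∈ 𝓛, ∑ q ∈ D with KPTouches (GeomInc R) 𝒞 {q}, a 𝒞 :=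
        sum_le_sum_of_subset_of_nonneg (filter_subset _ _) fun _ _ _ => sum_nonneg fun _ _ => ha _
    _ = ∑ q ∈ D, ∑ 𝒞 ∈ 𝓛 with KPTouches (GeomInc R) 𝒞 {q}, a 𝒞 := by
        rw [sum_comm' (t' := D) (s' := fun q => 𝓛.filter fun 𝒞 => KPTouches (GeomInc R) 𝒞 {q})]
        intro 𝒞 q
        simp only [mem_filter]
        tauto

/-- **LOCALITY OF `log Z` IN THE FACTORS.**  `R` symmetric with `≤ Δ` neighbours; two families of cell factors whose activities obey
`‖M(K)‖, ‖M'(K)‖ ≤ ε^{#K}` on `R`-connected `K` (`0 ≤ ε`, `eε(Δ+1)² ≤ 1∕2`) and AGREE on the polymers of `C` avoiding `D`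
(`K ⊆ C`, `K ∩ D = ∅ ⟹ M(K) = M'(K)`) ⟹ `‖log Z(C) − log Z'(C)‖ ≤ 2·#D·(Δ+1)·2eε`, uniformly in `C`. [folklore] -/
theorem act_norm_pertLogZ_sub_le_of_agree (hR : ∀ x y, R x y → R y x) (hΔ : ∀ x, (nbr x).card ≤ Δ)
    (hnbr : ∀ x y, R x y → y ∈ nbr x) (hact : ∀ K : Finset V, IsRConnected R K → ‖cellActivity μ g K‖ ≤ ε ^ K.card)
    (hact' : ∀ K : Finset V, IsRConnected R K → ‖cellActivity μ g' K‖ ≤ ε ^ K.card) (hε : 0 ≤ ε)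
    (hsmall : Real.exp 1 * ε * ((Δ : ℝ) + 1) ^ 2 ≤ 1 / 2) (C D : Finset V)
    (hagree : ∀ K : Finset V, K ⊆ C → Disjoint K D → cellActivity μ g K = cellActivity μ g' K) :
    ‖pertLogZ μ g R C - pertLogZ μ g' R C‖ ≤ 2 * (D.card * ((Δ : ℝ) + 1) * (2 * (Real.exp 1 * ε))) := by
  classical
  set L := rconnSubsets R C with hL
  set Φ : Finset (Finset V) → ℂ := truncatedWeight (GeomInc R) (connActivity R μ g) with hΦ
  set Φ' : Finset (Finset V) → ℂ := truncatedWeight (GeomInc R) (connActivity R μ g') with hΦ'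
  rw [pertLogZ_eq_sum_truncatedWeight, pertLogZ_eq_sum_truncatedWeight, ← sum_sub_distrib]
  -- clusters avoiding `D` cancel
  have hvanish : ∀ 𝒞 ∈ L.powerset, Φ 𝒞 - Φ' 𝒞 ≠ 0 → ∃ q ∈ D, KPTouches (GeomInc R) 𝒞 {q} := by
    intro 𝒞 h𝒞 hne
    by_contra hnot
    refine hne (sub_eq_zero.2 (truncatedWeight_congr fun Y hY => ?_))
    obtain ⟨hYC, hYconn⟩ := mem_rconnSubsets.1 (mem_powerset.1 h𝒞 hY)
    have hYD : Disjoint Y D := Finset.disjoint_left.2 fun q hqY hqD =>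
      hnot ⟨q, hqD, Y, hY, Or.inr ⟨q, hqY, q, mem_singleton_self q, Or.inl rfl⟩⟩
    unfold connActivity
    simp only [hYconn, if_true]
    exact hagree Y hYC hYD
  rw [← sum_filter_of_ne hvanish]
  -- clusters pinned at `D`
  have hpin := act_sum_norm_truncatedWeight_touching_le (μ := μ) hR hΔ hnbr hact hε hsmall C
  have hpin' := act_sum_norm_truncatedWeight_touching_le (μ := μ) hR hΔ hnbr hact' hε hsmall C
  calc ‖∑ 𝒞 ∈ L.powerset with ∃ q ∈ D, KPTouches (GeomInc R) 𝒞 {q}, (Φ 𝒞 - Φ' 𝒞)‖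
      ≤ ∑ 𝒞 ∈ L.powerset with ∃ q ∈ D, KPTouches (GeomInc R) 𝒞 {q}, ‖Φ 𝒞 - Φ' 𝒞‖ := norm_sum_le _ _
    _ ≤ ∑ 𝒞 ∈ L.powerset with ∃ q ∈ D, KPTouches (GeomInc R) 𝒞 {q}, (‖Φ 𝒞‖ + ‖Φ' 𝒞‖) :=
        sum_le_sum fun 𝒞 _ => norm_sub_le _ _
    _ ≤ ∑ q ∈ D, ∑ 𝒞 ∈ L.powerset with KPTouches (GeomInc R) 𝒞 {q}, (‖Φ 𝒞‖ + ‖Φ' 𝒞‖) :=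
        sum_norm_le_sum_pinned _ D _ fun 𝒞 => by positivity
    _ = ∑ q ∈ D, (∑ 𝒞 ∈ L.powerset with KPTouches (GeomInc R) 𝒞 {q}, ‖Φ 𝒞‖ +
          ∑ 𝒞 ∈ L.powerset with KPTouches (GeomInc R) 𝒞 {q}, ‖Φ' 𝒞‖) := sum_congr rfl fun q _ => sum_add_distrib
    _ ≤ ∑ q ∈ D, ((({q} : Finset V).card : ℝ) * ((Δ : ℝ) + 1) * (2 * (Real.exp 1 * ε)) +
          (({q} : Finset V).card : ℝ) * ((Δ : ℝ) + 1) * (2 * (Real.exp 1 * ε))) :=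
        sum_le_sum fun q _ => add_le_add (hpin {q}) (hpin' {q})
    _ = 2 * (D.card * ((Δ : ℝ) + 1) * (2 * (Real.exp 1 * ε))) := by
        simp only [card_singleton, Nat.cast_one, one_mul, sum_const, nsmul_eq_mul]
        ring

end Activity

/-! ## §2. Bridges for the road -/

/-- **`e^z = ↑r`, `r > 0` ⟹ `Re z = log r`** (`‖e^z‖ = e^{Re z}`). [folklore] -/
theorem re_eq_log_of_exp_eq {z : ℂ} {r : ℝ} (hr : 0 < r) (h : Complex.exp z = (r : ℂ)) : z.re = log r := by
  have h1 : ‖Complex.exp z‖ = r := by rw [h, Complex.norm_real, Real.norm_of_nonneg hr.le]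
  rw [Complex.norm_exp] at h1
  rw [← h1, log_exp]

section Road

variable {ι : Type} [Fintype ι] [DecidableEq ι]

omit [Fintype ι] [DecidableEq ι] [DecidableEq V] in
/-- **The road's shifted product over `K` sees `ψ` only on the cells of `K`.** [folklore] -/
theorem road_shift_prod_congr (cell : V → Finset ι) (w : ι → ℝ → ℝ) (K : Finset V) {ψ ψ' : EuclideanSpace ℝ ι}
    (hagree : ∀ p ∈ K, ∀ x ∈ cell p, ψ x = ψ' x) (ω : EuclideanSpace ℝ ι) :
    ∏ p ∈ K, (((exp (-(∑ x ∈ cell p, w x ((ω + ψ) x))) - 1 : ℝ)) : ℂ) =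
      ∏ p ∈ K, (((exp (-(∑ x ∈ cell p, w x ((ω + ψ') x))) - 1 : ℝ)) : ℂ) := by
  refine prod_congr rfl fun p hp => ?_
  have hsum : ∑ x ∈ cell p, w x ((ω + ψ) x) = ∑ x ∈ cell p, w x ((ω + ψ') x) :=
    sum_congr rfl fun x hx => by simp only [WithLp.ofLp_add, Pi.add_apply, hagree p hp x hx]
  rw [hsum]

omit [Fintype ι] [DecidableEq ι] [DecidableEq V] in
/-- **The road's shifted activities over `K` see `ψ` only on the cells of `K`.** [folklore] -/
theorem road_shift_cellActivity_congr (μ : Measure (EuclideanSpace ℝ ι)) (cell : V → Finset ι) (w : ι → ℝ → ℝ) (K : Finset V)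
    {ψ ψ' : EuclideanSpace ℝ ι} (hagree : ∀ p ∈ K, ∀ x ∈ cell p, ψ x = ψ' x) :
    cellActivity μ (fun p ω => (((exp (-(∑ x ∈ cell p, w x ((ω + ψ) x))) - 1 : ℝ)) : ℂ)) K =
      cellActivity μ (fun p ω => (((exp (-(∑ x ∈ cell p, w x ((ω + ψ') x))) - 1 : ℝ)) : ℂ)) K := by
  unfold cellActivity
  exact integral_congr_ae (ae_of_all _ fun ω => road_shift_prod_congr cell w K hagree ω)

/-! ## §3. THE END: the effective action is local in the external field -/

/-- **THE END — THE SMALL-FIELD EFFECTIVE ACTION IS A LOCAL FUNCTIONAL OF THE EXTERNAL FIELD.**  `Γ ⪰ 0` of range `ρ`, `Γ ⪯ γ_op·1`,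
diagonal `≤ γ` (`γ ≥ 0`); disjoint cells of `≤ v` sites; `R` symmetric covering `ρ`-closeness with `≤ Δ` neighbours; measurable remainders,
stable (`κ₀ ≥ 0`) and cubically small (`c₃` on `|t| ≤ h`); `2κ₀ ≤ κ`, `0 < τ`, `0 < θ < 1`, `κ(1+τ)γ_op ≤ θ`; two external fields `ψ, ψ'`
both with `Σ_{x∈cell p}ψ² ≤ Ψ²` on the cells of `S`, and EQUAL on the cells of `S ∖ D`; `e·ε_Ψ(h)A_τ^v(Δ+1)² ≤ 1∕2` ⟹
`|log ∫e^{−Σ_{p∈S}Σ_{x∈cell p}w_x(ω_x+ψ_x)}dN(0,Γ) − log ∫e^{−Σ_{p∈S}Σ_{x∈cell p}w_x(ω_x+ψ'_x)}dN(0,Γ)| ≤ 2·#D·(Δ+1)·2e·ε_Ψ(h)A_τ^v`,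
uniformly in `S`. [folklore] -/
theorem abs_log_smallField_sub_le {Γ : Matrix ι ι ℝ} {γop γ : ℝ} (hΓ : Γ.PosSemidef)
    (hΓop : (γop • (1 : Matrix ι ι ℝ) - Γ).PosSemidef) (hdiag : ∀ i, Γ i i ≤ γ) (hγ : 0 ≤ γ) {dι : ι → ι → ℕ} {ρ : ℕ}
    (hfr : HasFiniteRange dι ρ Γ) (cell : V → Finset ι) (hdisj : ∀ p q, p ≠ q → Disjoint (cell p) (cell q)) {v : ℕ}
    (hv : ∀ p, (cell p).card ≤ v) {R : V → V → Prop} [DecidableRel R] [Std.Symm R]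
    (hR : ∀ (p p' : V) (x y : ι), x ∈ cell p → y ∈ cell p' → dι x y ≤ ρ → p = p' ∨ R p p') {nbr : V → Finset V} {Δ : ℕ}
    (hΔ : ∀ x, (nbr x).card ≤ Δ) (hnbr : ∀ x y, R x y → y ∈ nbr x)
    (w : ι → ℝ → ℝ) (hw : ∀ x, Measurable (w x)) {κ₀ c₃ h κ τ θ Ψ : ℝ} (hκ₀ : 0 ≤ κ₀) (hc₃ : 0 ≤ c₃) (hh : 0 ≤ h)
    (hstab : ∀ x, ∀ t : ℝ, -(κ₀ * t ^ 2) ≤ w x t) (hcub : ∀ x, ∀ t : ℝ, |t| ≤ h → |w x t| ≤ c₃ * |t| ^ 3) (hκ : 2 * κ₀ ≤ κ)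
    (hτ : 0 < τ) (hθ0 : 0 < θ) (hθ1 : θ < 1) (hκθ : κ * (1 + τ) * γop ≤ θ) (S D : Finset V) (ψ ψ' : EuclideanSpace ℝ ι)
    (hψ : ∀ p ∈ S, ∑ x ∈ cell p, ψ x ^ 2 ≤ Ψ ^ 2) (hψ' : ∀ p ∈ S, ∑ x ∈ cell p, ψ' x ^ 2 ≤ Ψ ^ 2)
    (hagree : ∀ p ∈ S, p ∉ D → ∀ x ∈ cell p, ψ x = ψ' x)
    (hsmall : Real.exp 1 * (((max (exp (c₃ * v * h ^ 3) - 1) (2 * exp (-((κ / 2 - κ₀) * h ^ 2)))) *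
      exp (κ * (1 + τ⁻¹) * Ψ ^ 2 / 2)) * ((1 - θ) ^ (-(κ * (1 + τ) * γ / (2 * θ)))) ^ v) * ((Δ : ℝ) + 1) ^ 2 ≤ 1 / 2) :
    |log (∫ ω : EuclideanSpace ℝ ι, exp (-(∑ p ∈ S, ∑ x ∈ cell p, w x (ω x + ψ x))) ∂(multivariateGaussian 0 Γ)) -
        log (∫ ω : EuclideanSpace ℝ ι, exp (-(∑ p ∈ S, ∑ x ∈ cell p, w x (ω x + ψ' x))) ∂(multivariateGaussian 0 Γ))| ≤
      2 * (D.card * ((Δ : ℝ) + 1) * (2 * (Real.exp 1 * (((max (exp (c₃ * v * h ^ 3) - 1) (2 * exp (-((κ / 2 - κ₀) * h ^ 2)))) *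
        exp (κ * (1 + τ⁻¹) * Ψ ^ 2 / 2)) * ((1 - θ) ^ (-(κ * (1 + τ) * γ / (2 * θ)))) ^ v)))) := by
  set μ := multivariateGaussian 0 Γ with hμ
  set g : V → EuclideanSpace ℝ ι → ℂ := fun p ω => (((exp (-(∑ x ∈ cell p, w x (ω x))) - 1 : ℝ)) : ℂ) with hg
  have hκ' : 0 ≤ κ := by linarith
  have hκτ : 0 ≤ κ * (1 + τ) := mul_nonneg hκ' (by linarith)
  have hreg0 : ∀ p ω, ‖g p ω‖ ≤ max (exp (c₃ * v * h ^ 3) - 1) (2 * exp (-((κ / 2 - κ₀) * h ^ 2))) *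
      exp (κ * (∑ x ∈ cell p, ω x ^ 2) / 2) := road_factor_norm_le cell hv w hκ₀ hc₃ hh hstab hcub hκ
  have hmeas0 := road_factor_measurable cell w hw
  have hε0 := road_eps_nonneg c₃ v h κ κ₀
  have hεΨ : 0 ≤ max (exp (c₃ * v * h ^ 3) - 1) (2 * exp (-((κ / 2 - κ₀) * h ^ 2))) * exp (κ * (1 + τ⁻¹) * Ψ ^ 2 / 2) :=
    mul_nonneg hε0 (exp_pos _).le
  -- real logarithms are real parts of the KP logarithms
  have hreal : ∀ φ : EuclideanSpace ℝ ι, (∀ p ∈ S, ∑ x ∈ cell p, φ x ^ 2 ≤ Ψ ^ 2) →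
      (pertLogZ μ (fun p ω => g p (ω + φ)) R S).re =
        log (∫ ω : EuclideanSpace ℝ ι, exp (-(∑ p ∈ S, ∑ x ∈ cell p, w x (ω x + φ x))) ∂μ) := by
    intro φ hφ
    have hexp := shifted_exp_pertLogZ_on hΓ hΓop hdiag hγ hfr cell hdisj hv hR hΔ hnbr hε0 hκ' hτ hθ0 hθ1 hκθ S
      (fun p _ => hmeas0 p) (fun p _ ω => hreg0 p ω) φ hφ hsmall
    have hZ : pertZ μ (fun p ω => g p (ω + φ)) S =
        ((∫ ω : EuclideanSpace ℝ ι, exp (-(∑ p ∈ S, ∑ x ∈ cell p, w x (ω x + φ x))) ∂μ : ℝ) : ℂ) :=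
      pertZ_road_shift_eq μ cell w S φ
    rw [hZ] at hexp
    have hne : pertZ μ (fun p ω => g p (ω + φ)) S ≠ 0 := by rw [hZ, ← hexp]; exact Complex.exp_ne_zero _
    have hr0 : 0 ≤ ∫ ω : EuclideanSpace ℝ ι, exp (-(∑ p ∈ S, ∑ x ∈ cell p, w x (ω x + φ x))) ∂μ :=
      integral_nonneg fun ω => (exp_pos _).le
    have hr : 0 < ∫ ω : EuclideanSpace ℝ ι, exp (-(∑ p ∈ S, ∑ x ∈ cell p, w x (ω x + φ x))) ∂μ := by
      refine lt_of_le_of_ne hr0 fun h0 => hne ?_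
      rw [hZ, ← h0, Complex.ofReal_zero]
    exact re_eq_log_of_exp_eq hr hexp
  rw [← hreal ψ hψ, ← hreal ψ' hψ', ← Complex.sub_re]
  refine (Complex.abs_re_le_norm _).trans ?_
  -- localise to `S`, then the activity-level locality with the cut-off shifted families
  rw [← pertLogZ_cutoff μ (fun p ω => g p (ω + ψ)) R S, ← pertLogZ_cutoff μ (fun p ω => g p (ω + ψ')) R S]
  have hactφ : ∀ φ : EuclideanSpace ℝ ι, (∀ p ∈ S, ∑ x ∈ cell p, φ x ^ 2 ≤ Ψ ^ 2) → ∀ K : Finset V, IsRConnected R K →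
      ‖cellActivity μ (fun p ω => if p ∈ S then g p (ω + φ) else 0) K‖ ≤
        ((max (exp (c₃ * v * h ^ 3) - 1) (2 * exp (-((κ / 2 - κ₀) * h ^ 2))) * exp (κ * (1 + τ⁻¹) * Ψ ^ 2 / 2)) *
          ((1 - θ) ^ (-(κ * (1 + τ) * γ / (2 * θ)))) ^ v) ^ K.card :=
    fun φ hφ K _ => norm_cellActivity_le_of_regulated hΓ hΓop hdiag hγ cell hdisj hv hεΨ hκτ hθ0 hθ1 hκθ
      (cutoff_shifted_regulated cell hε0 hκ' hτ S (fun p _ ω => hreg0 p ω) φ hφ) K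
  have hA0 : 0 ≤ (max (exp (c₃ * v * h ^ 3) - 1) (2 * exp (-((κ / 2 - κ₀) * h ^ 2))) * exp (κ * (1 + τ⁻¹) * Ψ ^ 2 / 2)) *
      ((1 - θ) ^ (-(κ * (1 + τ) * γ / (2 * θ)))) ^ v := by
    have h1θ : 0 < 1 - θ := by linarith
    exact mul_nonneg hεΨ (pow_nonneg (rpow_pos_of_pos h1θ _).le _)
  refine act_norm_pertLogZ_sub_le_of_agree symm_of_inst hΔ hnbr (hactφ ψ hψ) (hactφ ψ' hψ') hA0 hsmall S D fun K hKS hKD => ?_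
  rw [cellActivity_cutoff_of_subset μ _ hKS, cellActivity_cutoff_of_subset μ _ hKS]
  exact road_shift_cellActivity_congr μ cell w K fun p hp x hx =>
    hagree p (hKS hp) (fun hpD => Finset.disjoint_left.1 hKD hp hpD) x hx

end Road

/-! ## §4. Toy -/

/-- Toy (§2): `e^0 = ↑1` gives `Re 0 = log 1`. -/
example : (0 : ℂ).re = log 1 := re_eq_log_of_exp_eq one_pos (by simp)

end Summit.QuantumFields.BalabanUV.T4Continuum.NE7b.SupEffectiveActionLocality
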